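import Mathlib
import Summits.Parity.BatemanHorn.Theses.IsogenyRedei
import HarnessLib

/-!
# Reduction of `SplitBlockJacobi` to the `h`-summed bulk root discrepancy (line `cofactor-root-discrepancy`)

Crux `IsogenyRedei.SplitBlockJacobi` (stmt-Parity-11583): `J_θ(x) = Σ_{t≤x} Σ_{Q<Q′ ∣ t²+1, Q > x^θ} (Q|Q′) = o(x)`.
The line sums over the free prime pair `(Q,Q′)` (`Q ≡ Q′ ≡ 1 (4)`, `x^θ < Q < Q′`, `QQ′ ≤ x²+1`) and splits the
small-root count `A_{QQ′}(x) = #{t ≤ x : QQ′ ∣ t²+1}` as `4x/(QQ′) + disc`.  This file records the COMPOSITION,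
kernel-checked and hypothesis-explicit: the pair-side Fubini identity (`h₁` = registered stub `stub_pairForm`),
the cancellation of the expected part (`h₂` = `stub_expectedPart`), the peelability of the small-cofactor tail
`QQ′ > x^{2−μ}` (`h₃` = `stub_smallCofactorTail`) and the `h`-summed bulk discrepancy statement (`hB`, the
line's residual "BulkDiscrepancyCancels", delivered by `stub_poissonReduction` from the twisted root Weyl sum
bounds) imply the crux.  The three stubs are being landed separately (`--supports stmt-Parity-11583`); with them
this becomes the unconditional reduction `BulkDiscrepancyCancels → SplitBlockJacobi` (lead
prover-line-stmt-Parity-11583-b-0, line `cofactor-root-discrepancy`).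
-/

noncomputable section

open Finset Filter

namespace Summit.Parity.BatemanHorn.Cruxes.SplitBlockJacobi.CofactorRootDiscrepancy

/-- **Reduction to the bulk discrepancy.** If (1) the pair-side Fubini identity holds for `x ≥ 4`,
(2) the expected part `Σ_{pairs} (Q|Q′)·4x/(QQ′)` is `o(x)`, (3) the small-cofactor tail is peelable,
and (B) for every tier `μ ∈ (0,1)` the weighted root discrepancy over the bulk `QQ′ ≤ x^{2−μ}` is `o(x)`,
then `SplitBlockJacobi` holds. Pure `ε/3` bookkeeping. -/
theorem splitBlockJacobi_of_bulkDiscrepancy :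
    (∀ θ : ℝ, 1 / 2 < θ → θ < 1 → ∀ x : ℕ, 4 ≤ x →
      (∑ t ∈ Finset.Icc 1 x, ∑ q ∈ ((t ^ 2 + 1).primeFactors ×ˢ (t ^ 2 + 1).primeFactors).filter
          (fun q : ℕ × ℕ => (x : ℝ) ^ θ < (q.1 : ℝ) ∧ q.1 < q.2), (jacobiSym (q.1 : ℤ) q.2 : ℝ)) =
      ∑ q ∈ (Finset.range (x ^ 2 + 2) ×ˢ Finset.range (x ^ 2 + 2)).filter (fun q : ℕ × ℕ =>
          q.1.Prime ∧ q.2.Prime ∧ q.1 % 4 = 1 ∧ q.2 % 4 = 1 ∧ (x : ℝ) ^ θ < (q.1 : ℝ) ∧ q.1 < q.2 ∧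
            q.1 * q.2 ≤ x ^ 2 + 1),
        (jacobiSym (q.1 : ℤ) q.2 : ℝ) *
          ((((Finset.Icc 1 x).filter (fun t : ℕ => q.1 * q.2 ∣ t ^ 2 + 1)).card : ℕ) : ℝ)) →
    (∀ θ : ℝ, 1 / 2 < θ → θ < 1 → ∀ ε : ℝ, 0 < ε → ∀ᶠ x : ℕ in Filter.atTop,
      |∑ q ∈ (Finset.range (x ^ 2 + 2) ×ˢ Finset.range (x ^ 2 + 2)).filter (fun q : ℕ × ℕ =>
          q.1.Prime ∧ q.2.Prime ∧ q.1 % 4 = 1 ∧ q.2 % 4 = 1 ∧ (x : ℝ) ^ θ < (q.1 : ℝ) ∧ q.1 < q.2 ∧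
            q.1 * q.2 ≤ x ^ 2 + 1),
        (jacobiSym (q.1 : ℤ) q.2 : ℝ) * (4 * (x : ℝ) / ((q.1 * q.2 : ℕ) : ℝ))| ≤ ε * x) →
    (∀ θ : ℝ, 1 / 2 < θ → θ < 1 → ∀ ε : ℝ, 0 < ε → ∃ μ : ℝ, 0 < μ ∧ μ < 1 ∧
      ∀ᶠ x : ℕ in Filter.atTop,
        |∑ q ∈ ((Finset.range (x ^ 2 + 2) ×ˢ Finset.range (x ^ 2 + 2)).filter (fun q : ℕ × ℕ =>
            q.1.Prime ∧ q.2.Prime ∧ q.1 % 4 = 1 ∧ q.2 % 4 = 1 ∧ (x : ℝ) ^ θ < (q.1 : ℝ) ∧ q.1 < q.2 ∧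
              q.1 * q.2 ≤ x ^ 2 + 1)).filter
            (fun q : ℕ × ℕ => ¬ ((q.1 * q.2 : ℕ) : ℝ) ≤ (x : ℝ) ^ (2 - μ)),
          (jacobiSym (q.1 : ℤ) q.2 : ℝ) *
            (((((Finset.Icc 1 x).filter (fun t : ℕ => q.1 * q.2 ∣ t ^ 2 + 1)).card : ℕ) : ℝ) -
              4 * (x : ℝ) / ((q.1 * q.2 : ℕ) : ℝ))| ≤ ε * x) →
    (∀ θ μ : ℝ, 1 / 2 < θ → θ < 1 → 0 < μ → μ < 1 → ∀ ε : ℝ, 0 < ε →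
      ∀ᶠ x : ℕ in Filter.atTop,
        |∑ q ∈ ((Finset.range (x ^ 2 + 2) ×ˢ Finset.range (x ^ 2 + 2)).filter (fun q : ℕ × ℕ =>
            q.1.Prime ∧ q.2.Prime ∧ q.1 % 4 = 1 ∧ q.2 % 4 = 1 ∧ (x : ℝ) ^ θ < (q.1 : ℝ) ∧ q.1 < q.2 ∧
              q.1 * q.2 ≤ x ^ 2 + 1)).filter
            (fun q : ℕ × ℕ => ((q.1 * q.2 : ℕ) : ℝ) ≤ (x : ℝ) ^ (2 - μ)),
          (jacobiSym (q.1 : ℤ) q.2 : ℝ) *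
            (((((Finset.Icc 1 x).filter (fun t : ℕ => q.1 * q.2 ∣ t ^ 2 + 1)).card : ℕ) : ℝ) -
              4 * (x : ℝ) / ((q.1 * q.2 : ℕ) : ℝ))| ≤ ε * x) →
    Summit.Parity.BatemanHorn.Theses.IsogenyRedei.SplitBlockJacobi := by
  intro h₁ h₂ h₃ hB θ hθ₁ hθ₂
  rw [Asymptotics.isLittleO_iff]
  intro c hc
  have hc3 : 0 < c / 3 := by positivity
  obtain ⟨μ, hμ0, hμ1, hT⟩ := h₃ θ hθ₁ hθ₂ (c / 3) hc3
  have hBx := hB θ μ hθ₁ hθ₂ hμ0 hμ1 (c / 3) hc3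
  have hE := h₂ θ hθ₁ hθ₂ (c / 3) hc3
  filter_upwards [hT, hBx, hE, eventually_ge_atTop 4] with x hxT hxB hxE hx4
  -- abbreviations
  set P : Finset (ℕ × ℕ) := (Finset.range (x ^ 2 + 2) ×ˢ Finset.range (x ^ 2 + 2)).filter
    (fun q : ℕ × ℕ => q.1.Prime ∧ q.2.Prime ∧ q.1 % 4 = 1 ∧ q.2 % 4 = 1 ∧ (x : ℝ) ^ θ < (q.1 : ℝ) ∧
      q.1 < q.2 ∧ q.1 * q.2 ≤ x ^ 2 + 1) with hP
  set A : ℕ × ℕ → ℝ := fun q =>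
    ((((Finset.Icc 1 x).filter (fun t : ℕ => q.1 * q.2 ∣ t ^ 2 + 1)).card : ℕ) : ℝ) with hA
  set jac : ℕ × ℕ → ℝ := fun q => (jacobiSym (q.1 : ℤ) q.2 : ℝ) with hjac
  set E : ℝ := ∑ q ∈ P, jac q * (4 * (x : ℝ) / ((q.1 * q.2 : ℕ) : ℝ)) with hEdef
  set Db : ℝ := ∑ q ∈ P.filter (fun q : ℕ × ℕ => ((q.1 * q.2 : ℕ) : ℝ) ≤ (x : ℝ) ^ (2 - μ)),
    jac q * (A q - 4 * (x : ℝ) / ((q.1 * q.2 : ℕ) : ℝ)) with hDb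
  set Dt : ℝ := ∑ q ∈ P.filter (fun q : ℕ × ℕ => ¬ ((q.1 * q.2 : ℕ) : ℝ) ≤ (x : ℝ) ^ (2 - μ)),
    jac q * (A q - 4 * (x : ℝ) / ((q.1 * q.2 : ℕ) : ℝ)) with hDt
  have hsplit : (∑ t ∈ Finset.Icc 1 x, ∑ q ∈ ((t ^ 2 + 1).primeFactors ×ˢ (t ^ 2 + 1).primeFactors).filter
      (fun q : ℕ × ℕ => (x : ℝ) ^ θ < (q.1 : ℝ) ∧ q.1 < q.2), (jacobiSym (q.1 : ℤ) q.2 : ℝ)) =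
      E + (Db + Dt) := by
    rw [h₁ θ hθ₁ hθ₂ x hx4]
    have hpt : ∀ q ∈ P, jac q * A q =
        jac q * (4 * (x : ℝ) / ((q.1 * q.2 : ℕ) : ℝ)) +
          jac q * (A q - 4 * (x : ℝ) / ((q.1 * q.2 : ℕ) : ℝ)) := by
      intro q _
      ring
    rw [Finset.sum_congr rfl hpt, Finset.sum_add_distrib, hEdef, hDb, hDt,
      Finset.sum_filter_add_sum_filter_not]
  change ‖_‖ ≤ c * ‖(x : ℝ)‖
  rw [hsplit, Real.norm_eq_abs, Real.norm_eq_abs, Nat.abs_cast]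
  have hA1 := abs_add_le E (Db + Dt)
  have hA2 := abs_add_le Db Dt
  have hxE' : |E| ≤ c / 3 * x := hxE
  have hxB' : |Db| ≤ c / 3 * x := hxB
  have hxT' : |Dt| ≤ c / 3 * x := hxT
  linarith

end Summit.Parity.BatemanHorn.Cruxes.SplitBlockJacobi.CofactorRootDiscrepancy

end
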